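import Summits.Langlands.Langlands.Statement
import Summits.Langlands.Langlands.Theorems.SoloBlindUniqueness
import Summits.Langlands.Langlands.Theorems.SoloBlindReciprocityTransfer
import Literature.NumberTheory.Automorphic.LocalComponentBJUniqueProofs
import Literature.FieldTheory.AlgClosed.PadicAlgClEquivComplex
import HarnessLib

/-!
# `Langlands` ⇒ local agreement: the quantifier `∀ 𝓡` of the summit is EXACTLY local agreement

`SoloBlind.langlands_of_one_datum` (file `SoloBlindReciprocityTransfer`) showed that summit
`Langlands` follows from non-vacuity, LOCAL AGREEMENT (any two pinned data give the same class to the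
local components of the L-algebraic cuspidal `π`) and reciprocity for ONE datum.  This file proves the
converse direction `Langlands → local agreement` (`SoloBlind.recGL_eq_of_globalLanglands`), hence the
characterisation `SoloBlind.langlands_iff_one_datum`:

  `Langlands ↔ ∀ F, (NV) ∧ (LA for n ≥ 1) ∧ ∀ n ≥ 1, ∀ hcpt, ∃ 𝓡₀, (A∃)(𝓡₀) ∧ (B)(𝓡₀)`,

modulo three pieces of Weil–Deligne bookkeeping over the local fields `K_v`, taken as explicit
hypotheses and each a routine consequence of theorems already in the tree:
(WD-A) the Grothendieck–Deligne relation `IsWeilDeligneOfLadic` is covariant under conjugation of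
`ρ|_{W_{K_v}}` up to isomorphism (tree: `IsWeilDeligneOfLadic.isEquivalent_holds`, Deligne 1973 §8.4.2,
plus conjugation of the recipe); (WD-B) transport along `ι : ℚ̄_ℓ ≅ ℂ` (`IsTransportAlong`) preserves
isomorphism; (WD-C) the Frobenius-semisimple class `HasFrobSemisimpleClass` is an isomorphism
invariant (tree: `existsUnique_frobSemisimplification_holds`, Deligne 1973 §8.5–8.6).
The argument: for `π` L-algebraic cuspidal and a finite place `v`, pick a prime `ℓ` not below `v`
(`2` or `3`) and `ι`; (A) for `𝓡` and for `𝓡'` give `ρ`, `ρ'` corresponding to `π`; they share the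
datum-free Satake clause, so `ρ' = g ρ g⁻¹` (`SoloBlind.isConjugate_of_eventually`: Chebotarev,
Brauer–Nesbitt); local–global compatibility at `v ∤ ℓ` for both, read through (WD-A,B,C), identifies
`rec_𝓡(π_v)` with `rec_𝓡'(π_v')` for the two local components, and local components are unique up
to isomorphism (tree: `hasLocalComponentAt_unique_holds`, Flath 1979).

## References

* P. Deligne, *Les constantes des équations fonctionnelles des fonctions L*, Antwerp II, LNM 349
  (1973), §8.4–8.6. [DeligneAntwerpII1973]
* D. Flath, *Decomposition of representations into tensor products*, Corvallis 1979, Thm. 3–4.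
  [FlathCorvallis1979]
* G. Henniart, *Caractérisation de la correspondance de Langlands locale par les facteurs ε de
  paires*, Invent. Math. 113 (1993). [Henniart1993]
* K. Buzzard, T. Gee, LMS Lecture Notes 414 (2014), Conj. 3.2.1–3.2.2. [BuzzardGeeLMS2014]
-/

open scoped MatrixGroups Matrix Classical NumberField
open NumberField IsDedekindDomain Filter Field
open Literature.NumberTheory.Automorphic Literature.NumberTheory.GaloisRepresentations

noncomputable section

namespace Summit.Langlands.Langlands.Theorems

namespace SoloBlind

variable {K : Type} [Field K] [NumberField K] {n : ℕ}

omit [NumberField K] in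
/-- At least one of the primes `2`, `3` does not lie below the finite place `v`. [folklore] -/
theorem exists_prime_natCast_not_mem (v : HeightOneSpectrum (𝓞 K)) :
    ∃ ℓ : ℕ, ℓ.Prime ∧ ((ℓ : ℕ) : 𝓞 K) ∉ v.asIdeal := by
  by_contra! h
  have h1 : (1 : 𝓞 K) ∈ v.asIdeal := by
    have e : (((3 : ℕ) : 𝓞 K)) - ((2 : ℕ) : 𝓞 K) = 1 := by norm_num
    rw [← e]
    exact v.asIdeal.sub_mem (h 3 Nat.prime_three) (h 2 Nat.prime_two)
  exact v.isPrime.ne_top ((Ideal.eq_top_iff_one _).2 h1)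

/-- Two representations corresponding to the same `π` under two (possibly different) data share the
datum-free Satake clause: common unramified places and Frobenius polynomials almost everywhere.
[cite: BuzzardGeeLMS2014, Conj. 3.2.1] -/
theorem eventually_frobCharpoly_of_corresponds₂ {ℓ : ℕ} [Fact ℓ.Prime] {𝓡 𝓡' : ReciprocityData K}
    {hcpt : isCompact_glFiniteIntegralLevel n K} {ι : PadicAlgCl ℓ ≃+* ℂ}
    {π : AutomorphicRepData (AutomorphyDatum.gl n K hcpt)} {ρ ρ' : FramedGaloisRep K (PadicAlgCl ℓ) n}
    (h : Corresponds 𝓡 ι π ρ) (h' : Corresponds 𝓡' ι π ρ') :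
    ∀ᶠ v : HeightOneSpectrum (𝓞 K) in cofinite,
      ρ.IsUnramifiedAt v ∧ ρ'.IsUnramifiedAt v ∧
        ∃ P : Polynomial (PadicAlgCl ℓ), ρ.HasFrobCharpolyAt v P ∧ ρ'.HasFrobCharpolyAt v P := by
  filter_upwards [h.1, h'.1] with v ⟨α, hα, hur, hP⟩ ⟨α', hα', hur', hP'⟩
  obtain rfl : α = α' := π.hasSatakeParamAt_unique_holds hα hα'
  exact ⟨hur, hur', _, hP, hP'⟩

/-- Restriction to the Weil group of `K_v` commutes with conjugation. [folklore] -/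
theorem toWeilGroupHom_toLocal_conj {ℓ : ℕ} [Fact ℓ.Prime] (g : GL (Fin n) (PadicAlgCl ℓ))
    (ρ : FramedGaloisRep K (PadicAlgCl ℓ) n) (v : HeightOneSpectrum (𝓞 K)) :
    FramedRep.toWeilGroupHom (FramedGaloisRep.toLocal v (FramedRep.conj g ρ)) =
      (MulAut.conj g).toMonoidHom.comp (ρ.toLocal v).toWeilGroupHom := by
  ext1 w
  simp [FramedRep.toWeilGroupHom_apply, FramedGaloisRep.toLocal_apply]

/-- **Reciprocity for two data forces local agreement on cuspidal local components** — modulo the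
Weil–Deligne bookkeeping (WD-A), (WD-B), (WD-C) of the module docstring.  If
`GlobalLanglandsCorrespondenceGLn n K` holds for `𝓡` and for `𝓡'` then for every L-algebraic cuspidal
`π` of `GL_n(𝔸_K)`, every finite `v` and every local component `π_v`,
`rec_𝓡(π_v) = rec_𝓡'(π_v)`. [cite: DeligneAntwerpII1973, §8.4.2] [cite: FlathCorvallis1979, Thm. 3]
[cite: BuzzardGeeLMS2014, Conj. 3.2.2] -/
theorem recGL_eq_of_globalLanglands {𝓡 𝓡' : ReciprocityData K}
    {hcpt : isCompact_glFiniteIntegralLevel n K}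
    (hA : ∀ (v : HeightOneSpectrum (𝓞 K)) (ℓ : ℕ) [Fact ℓ.Prime]
      (ρW : WeilGroup (v.adicCompletion K) →* GL (Fin n) (PadicAlgCl ℓ))
      (g : GL (Fin n) (PadicAlgCl ℓ))
      (r r' : WeilDeligneRep (v.adicCompletion K) (PadicAlgCl ℓ) (Fin n → PadicAlgCl ℓ)),
      IsWeilDeligneOfLadic ρW r → IsWeilDeligneOfLadic ((MulAut.conj g).toMonoidHom.comp ρW) r' →
        r.IsEquivalent r')
    (hB : ∀ (v : HeightOneSpectrum (𝓞 K)) (ℓ : ℕ) [Fact ℓ.Prime] (ι : PadicAlgCl ℓ ≃+* ℂ)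
      (r r' : WeilDeligneRep (v.adicCompletion K) (PadicAlgCl ℓ) (Fin n → PadicAlgCl ℓ))
      (rℂ rℂ' : WeilDeligneRep (v.adicCompletion K) ℂ (Fin n → ℂ)),
      r.IsEquivalent r' → r.IsTransportAlong (ι : PadicAlgCl ℓ →+* ℂ) rℂ →
        r'.IsTransportAlong (ι : PadicAlgCl ℓ →+* ℂ) rℂ' → rℂ.IsEquivalent rℂ')
    (hC : ∀ (v : HeightOneSpectrum (𝓞 K)) (rℂ rℂ' : WeilDeligneRep (v.adicCompletion K) ℂ (Fin n → ℂ))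
      (c c' : Quotient (frobSemisimpleWDSetoid (v.adicCompletion K) n)),
      rℂ.IsEquivalent rℂ' → rℂ.HasFrobSemisimpleClass c → rℂ'.HasFrobSemisimpleClass c' → c = c')
    (h : GlobalLanglandsCorrespondenceGLn n K 𝓡 hcpt) (h' : GlobalLanglandsCorrespondenceGLn n K 𝓡' hcpt)
    (π : CuspidalAutomorphicRepData n K hcpt) (hπ : π.1.IsLAlgebraic) (v : HeightOneSpectrum (𝓞 K))
    (πv : SmoothIrrep (GL (Fin n) (v.adicCompletion K))) (hπv : π.1.HasLocalComponentAt v πv.ρ) :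
    (𝓡.llc v).recGL n (IrrClass.mk πv) = (𝓡'.llc v).recGL n (IrrClass.mk πv) := by
  obtain ⟨ℓ, hℓ, hℓv⟩ := exists_prime_natCast_not_mem v
  haveI : Fact ℓ.Prime := ⟨hℓ⟩
  obtain ⟨ι⟩ := PadicAlgCl.nonempty_ringEquiv_complex ℓ
  obtain ⟨ρ, hirr, -, hcorr, -⟩ := h.1 π hπ ℓ ι
  obtain ⟨ρ', -, -, hcorr', -⟩ := h'.1 π hπ ℓ ι
  obtain ⟨g, hg⟩ := isConjugate_of_eventually ρ ρ' hirr (eventually_frobCharpoly_of_corresponds₂ hcorr hcorr')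
  obtain ⟨πv₁, r, rℂ, hlc, hWD, -, htr, hcl⟩ := hcorr.2 v
  obtain ⟨πv₂, r', rℂ', hlc', hWD', -, htr', hcl'⟩ := hcorr'.2 v
  have hρ'W : (ρ'.toLocal v).toWeilGroupHom =
      (MulAut.conj g).toMonoidHom.comp (ρ.toLocal v).toWeilGroupHom := by
    rw [← hg]
    exact toWeilGroupHom_toLocal_conj g ρ v
  have e₁ : r.IsEquivalent r' := hA v ℓ _ g r r' (hWD hℓv) (hρ'W ▸ hWD' hℓv)
  have e₂ : rℂ.IsEquivalent rℂ' := hB v ℓ ι r r' rℂ rℂ' e₁ htr htr'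
  have e₃ := hC v rℂ rℂ' _ _ e₂ hcl hcl'
  have u₁ : IrrClass.mk πv = IrrClass.mk πv₁ :=
    AutomorphicRepData.hasLocalComponentAt_unique_holds π.1 v πv πv₁ hπv hlc
  have u₂ : IrrClass.mk πv = IrrClass.mk πv₂ :=
    AutomorphicRepData.hasLocalComponentAt_unique_holds π.1 v πv πv₂ hπv hlc'
  calc (𝓡.llc v).recGL n (IrrClass.mk πv) = (𝓡.llc v).recGL n (IrrClass.mk πv₁) := by rw [u₁]
    _ = (𝓡'.llc v).recGL n (IrrClass.mk πv₂) := e₃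
    _ = (𝓡'.llc v).recGL n (IrrClass.mk πv) := by rw [← u₂]

/-- **Characterisation of the summit's quantifier over reciprocity data** (modulo (WD-A,B,C) at every
number field): `Langlands` holds iff for every number field `F` (i) a pinned datum exists, (ii) LOCAL
AGREEMENT in every degree `n ≥ 1` — any two pinned data give the same class to the local components of
the L-algebraic cuspidal `π` of `GL_n(𝔸_F)` — and (iii) reciprocity ((A) in existence form and (B))
holds in every degree `n ≥ 1` for ONE datum.  (ii) is, in print, genericity of cuspidal local
components (Shalika 1974) with Henniart's characterisation of the local correspondence on generic
classes (1993); it is not in the tree for `n ≥ 2`.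
[cite: Henniart1993, Thm. 1.1] [cite: Shalika1974, Thm. 5.5] [cite: BuzzardGeeLMS2014, Conj. 3.2.2] -/
theorem langlands_iff_one_datum
    (hA : ∀ (F : Type) [Field F] [NumberField F] (n : ℕ) (v : HeightOneSpectrum (𝓞 F)) (ℓ : ℕ)
      [Fact ℓ.Prime] (ρW : WeilGroup (v.adicCompletion F) →* GL (Fin n) (PadicAlgCl ℓ))
      (g : GL (Fin n) (PadicAlgCl ℓ))
      (r r' : WeilDeligneRep (v.adicCompletion F) (PadicAlgCl ℓ) (Fin n → PadicAlgCl ℓ)),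
      IsWeilDeligneOfLadic ρW r → IsWeilDeligneOfLadic ((MulAut.conj g).toMonoidHom.comp ρW) r' →
        r.IsEquivalent r')
    (hB : ∀ (F : Type) [Field F] [NumberField F] (n : ℕ) (v : HeightOneSpectrum (𝓞 F)) (ℓ : ℕ)
      [Fact ℓ.Prime] (ι : PadicAlgCl ℓ ≃+* ℂ)
      (r r' : WeilDeligneRep (v.adicCompletion F) (PadicAlgCl ℓ) (Fin n → PadicAlgCl ℓ))
      (rℂ rℂ' : WeilDeligneRep (v.adicCompletion F) ℂ (Fin n → ℂ)),
      r.IsEquivalent r' → r.IsTransportAlong (ι : PadicAlgCl ℓ →+* ℂ) rℂ →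
        r'.IsTransportAlong (ι : PadicAlgCl ℓ →+* ℂ) rℂ' → rℂ.IsEquivalent rℂ')
    (hC : ∀ (F : Type) [Field F] [NumberField F] (n : ℕ) (v : HeightOneSpectrum (𝓞 F))
      (rℂ rℂ' : WeilDeligneRep (v.adicCompletion F) ℂ (Fin n → ℂ))
      (c c' : Quotient (frobSemisimpleWDSetoid (v.adicCompletion F) n)),
      rℂ.IsEquivalent rℂ' → rℂ.HasFrobSemisimpleClass c → rℂ'.HasFrobSemisimpleClass c' → c = c') :
    Langlands ↔
      ∀ (F : Type) [Field F] [NumberField F],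
        Nonempty (Summit.Langlands.ReciprocityData F) ∧
        (∀ (𝓡 𝓡' : Summit.Langlands.ReciprocityData F) (n : ℕ), 0 < n →
          ∀ (hcpt : isCompact_glFiniteIntegralLevel n F) (π : CuspidalAutomorphicRepData n F hcpt),
            π.1.IsLAlgebraic →
              ∀ (v : HeightOneSpectrum (𝓞 F)) (πv : SmoothIrrep (GL (Fin n) (v.adicCompletion F))),
                π.1.HasLocalComponentAt v πv.ρ →
                  (𝓡.llc v).recGL n (IrrClass.mk πv) = (𝓡'.llc v).recGL n (IrrClass.mk πv)) ∧
        ∀ (n : ℕ), 0 < n → ∀ hcpt : isCompact_glFiniteIntegralLevel n F,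
          ∃ 𝓡₀ : Summit.Langlands.ReciprocityData F,
            (∀ π : CuspidalAutomorphicRepData n F hcpt, π.1.IsLAlgebraic →
              ∀ (ℓ : ℕ) [Fact ℓ.Prime] (ι : PadicAlgCl ℓ ≃+* ℂ),
                ∃ ρ : FramedGaloisRep F (PadicAlgCl ℓ) n,
                  ρ.toGaloisRep.IsIrreducible ∧ IsGeometricFramed 𝓡₀ ρ ∧ Corresponds 𝓡₀ ι π.1 ρ) ∧
            GaloisToAutomorphic n 𝓡₀ hcpt := by
  constructor
  · intro h F _ _
    refine ⟨(h F).1, fun 𝓡 𝓡' n hn hcpt π hπ v πv hπv ↦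
      recGL_eq_of_globalLanglands (hA F n) (hB F n) (hC F n) ((h F).2 𝓡 n hn hcpt)
        ((h F).2 𝓡' n hn hcpt) π hπ v πv hπv, fun n hn hcpt ↦ ?_⟩
    obtain ⟨𝓡₀⟩ := (h F).1
    exact ⟨𝓡₀, (automorphicToGalois_iff_exists 𝓡₀ hcpt).1 ((h F).2 𝓡₀ n hn hcpt).1,
      ((h F).2 𝓡₀ n hn hcpt).2⟩
  · intro h
    refine langlands_of_exists fun F _ _ ↦ ⟨(h F).1, fun 𝓡 n hn hcpt ↦ ?_⟩
    obtain ⟨𝓡₀, hA₀, hB₀⟩ := (h F).2.2 n hn hcpt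
    have hglc : GlobalLanglandsCorrespondenceGLn n F 𝓡 hcpt :=
      globalLanglandsCorrespondenceGLn_of_recGL_eq n F
        (fun π hπ v πv hv ↦ (h F).2.1 𝓡₀ 𝓡 n hn hcpt π hπ v πv hv)
        ⟨(automorphicToGalois_iff_exists 𝓡₀ hcpt).2 hA₀, hB₀⟩
    exact ⟨(automorphicToGalois_iff_exists 𝓡 hcpt).1 hglc.1, hglc.2⟩

end SoloBlind

end Summit.Langlands.Langlands.Theorems

end
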